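import Summits.CriticalPhenomena.PercolationContinuityZ3.Theorems.PercNearOneGluingNoHeavyLowerTailTraceGluing
import HarnessLib

/-!
# `NoHeavyLowerTail` (stmt-CriticalPhenomena-4575) — the BLOCK TWO-POINT STEP of worst-first gluing:
# a worse BLOCK `S` and a better relay `y` glue like two relays

Support file (prover prim-gen-kcluster gen 3; `--supports stmt-CriticalPhenomena-4575`).  No definitions, no sorries.
Setting: `μ = prodBernoulli w` on a finite vertex type, observer `o`, sink `b`, a finite vertex set `S` (a "block" of
relays) and a relay `y`; `S ↮ b` means every `s ∈ S` is cut from `b`, `o ↔ S` means `o` is joined to some `s ∈ S`,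
`y ↮ S` that `y` is joined to no `s ∈ S`.  Put `D_S = {S ↮ b, y ↮ b}`, `L = D_S ∩ {y ↮ S}`.

* `blockStep` (PROVED): if `μ(y ↮ b) ≤ μ(S ↮ b)` (the block is WORSE than `y`) and `μ(L) > 0`, then
  `P(o ↔ S | S ↮ b) + P(y ↮ S | y ↮ b) · P(o ↔ y | L) ≤ P(o ↔ S ∪ y | D_S)`.
* `blockGluing_two` (PROVED, same hypotheses): `P(o ↔ S | S ↮ b) + P(o ↔ y, o ↮ S | y ↮ b) ≤ P(o ↔ S ∪ y | D_S) (≤ 1)`.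
  For `S = {x}` this is the two-relay worst-first gluing inequality (`worstFirst_two_mul`) in the strengthened form
  `P(o↔x | x↮b) + P(o↔y, o↮x | y↮b) ≤ P(o↔{x,y} | x↮b, y↮b)`; for `|S| ≥ 2` it is the induction step
  "merge the block of the `j−1` worst relays with the `j`-th": iterating it proves worst-first gluing (hence event
  gluing and both crux reductions of `…WorstFirstGluing.lean`) for every relay list satisfying the PREFIX CONDITION
  `μ(a_1,…,a_{j−1} ↮ b) ≥ μ(a_j ↮ b)` for all `j`.  The block hypothesis is essential: numerically the inequality fails
  without it even when every `s ∈ S` is individually worse than `y` (seat report KCLUSTER-gen3.md).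
Proof (new): two instances of BHK's two-set exchange (`Literature.…setTwoClusterExchange`) — `attach_le_cut_block`
(`S_ex = S`, `T = {b, y}`) and `join_posCorr_block` (`S_ex = {b}`, `T = S ∪ {y}`) — the order hypothesis in the form
`μ(S↮b, y↔b) ≥ μ(y↮b, S ∩ C_b ≠ ∅)`, and the exact identity
`N·d_S·d_y·q − D·[(c+n+J)·d_y·q + (q+X)·n_y·d_S] = U·q·d_y − n_y·X·m·d_S` (notation in the proof).
-/

noncomputable section

namespace Summit.CriticalPhenomena.PercolationContinuityZ3.Theorems

open MeasureTheory Set Literature.Probability.LatticeModels Literature.Probability.Percolation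
open scoped Classical BigOperators
open PathExchange (rs)

namespace BlockStep

variable {V : Type*}

/-- Row 1 (raw two-set exchange, `S_ex = S`, `T = {b, y}`):
`μ(D ∩ {S↔o} ∩ {b↔y}) · μ(D ∩ {b↮y}) ≤ μ(D ∩ {S↔o} ∩ {b↮y}) · μ(D ∩ {b↔y})`, `D = {S ↮ b, S ↮ y}`.
[cite: VandenbergHaggstromKahn2005, Thm. 2.1 (p. 9) at q = 1 with Remark 1 (p. 5) — corollary via `setTwoClusterExchange`, derived in this file] -/
theorem attach_le_cut_block_set [Fintype V] (w : Sym2 V → unitInterval) (S : Finset V) (o b y : V) :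
    (prodBernoulli w).real ({ω : BondConfig V | ∀ s ∈ (↑S : Set V), ∀ t ∈ ({b, y} : Set V),
        ¬ (openGraph ω).Reachable s t} ∩ ((⋃ s ∈ S, (openConn s o : Set (BondConfig V))) ∩ openConn b y)) *
      (prodBernoulli w).real ({ω : BondConfig V | ∀ s ∈ (↑S : Set V), ∀ t ∈ ({b, y} : Set V),
        ¬ (openGraph ω).Reachable s t} ∩ ((openConn b y : Set (BondConfig V))ᶜ ∩ univ)) ≤
    (prodBernoulli w).real ({ω : BondConfig V | ∀ s ∈ (↑S : Set V), ∀ t ∈ ({b, y} : Set V),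
        ¬ (openGraph ω).Reachable s t} ∩ ((⋃ s ∈ S, (openConn s o : Set (BondConfig V))) ∩ (openConn b y)ᶜ)) *
      (prodBernoulli w).real ({ω : BondConfig V | ∀ s ∈ (↑S : Set V), ∀ t ∈ ({b, y} : Set V),
        ¬ (openGraph ω).Reachable s t} ∩ ((openConn b y : Set (BondConfig V)) ∩ univ)) := by
  set Sx : Set V := ↑S with hSx
  set T : Set V := {b, y} with hT
  have hbT : b ∈ T := by rw [hT]; exact mem_insert b {y}
  exact setTwoClusterExchange w Sx T
    (A₁ := ⋃ s ∈ S, (openConn s o : Set (BondConfig V))) (A₂ := (openConn b y : Set (BondConfig V))ᶜ)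
    (B₁ := (openConn b y : Set (BondConfig V))) (B₂ := univ)
    (fun ω ω' hs ht h => by
      obtain ⟨s, hsS, hω⟩ := mem_iUnion₂.1 h
      exact mem_iUnion₂.2 ⟨s, hsS, TwoSetExchange.typePlus_openConn_of_mem Sx T
        (by rw [hSx]; exact Finset.mem_coe.2 hsS) o hs ht hω⟩)
    (fun ω ω' hs ht h => TwoSetExchange.typePlus_not_openConn_of_mem Sx T hbT y hs ht h)
    (fun ω ω' hs ht h => TwoSetExchange.typeMinus_openConn_of_mem Sx T hbT y hs ht h)
    (fun _ _ _ _ _ => mem_univ _)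

/-- Row 2 (raw two-set exchange, `S_ex = {b}`, `T = S ∪ {y}`): with `D = {b ↮ S ∪ y}`, `O = {S↔o} ∪ {y↔o}`,
`Y = {y ↔ S}`: `μ(D ∩ O) · μ(D ∩ Y) ≤ μ(D) · μ(D ∩ O ∩ Y)`.
[cite: VandenbergHaggstromKahn2005, Thm. 2.1 (p. 9) at q = 1 with Remark 1 (p. 5) — corollary via `setTwoClusterExchange`, derived in this file] -/
theorem join_posCorr_block_set [Fintype V] (w : Sym2 V → unitInterval) (S : Finset V) (o b y : V) :
    (prodBernoulli w).real ({ω : BondConfig V | ∀ s ∈ ({b} : Set V), ∀ t ∈ (insert y ↑S : Set V),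
        ¬ (openGraph ω).Reachable s t} ∩ (univ ∩ ((⋃ s ∈ S, (openConn s o : Set (BondConfig V))) ∪ openConn y o))) *
      (prodBernoulli w).real ({ω : BondConfig V | ∀ s ∈ ({b} : Set V), ∀ t ∈ (insert y ↑S : Set V),
        ¬ (openGraph ω).Reachable s t} ∩ (univ ∩ ⋃ s ∈ S, (openConn y s : Set (BondConfig V)))) ≤
    (prodBernoulli w).real ({ω : BondConfig V | ∀ s ∈ ({b} : Set V), ∀ t ∈ (insert y ↑S : Set V),
        ¬ (openGraph ω).Reachable s t} ∩ (univ ∩ univ)) *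
      (prodBernoulli w).real ({ω : BondConfig V | ∀ s ∈ ({b} : Set V), ∀ t ∈ (insert y ↑S : Set V),
        ¬ (openGraph ω).Reachable s t} ∩
          (((⋃ s ∈ S, (openConn s o : Set (BondConfig V))) ∪ openConn y o) ∩
            ⋃ s ∈ S, (openConn y s : Set (BondConfig V)))) := by
  set Sx : Set V := {b} with hSx
  set T : Set V := insert y ↑S with hT
  have hyT : y ∈ T := by rw [hT]; exact mem_insert y _
  have hsT : ∀ s ∈ S, s ∈ T := fun s hs => by rw [hT]; exact mem_insert_of_mem y (Finset.mem_coe.2 hs)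
  exact setTwoClusterExchange w Sx T (A₁ := univ) (A₂ := univ)
    (B₁ := (⋃ s ∈ S, (openConn s o : Set (BondConfig V))) ∪ openConn y o)
    (B₂ := ⋃ s ∈ S, (openConn y s : Set (BondConfig V)))
    (fun _ _ _ _ _ => mem_univ _) (fun _ _ _ _ _ => mem_univ _)
    (fun ω ω' hs ht h => h.elim
      (fun h1 => by
        obtain ⟨s, hsS, hω⟩ := mem_iUnion₂.1 h1
        exact Or.inl (mem_iUnion₂.2 ⟨s, hsS,
          TwoSetExchange.typeMinus_openConn_of_mem Sx T (hsT s hsS) o hs ht hω⟩))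
      (fun h2 => Or.inr (TwoSetExchange.typeMinus_openConn_of_mem Sx T hyT o hs ht h2)))
    (fun ω ω' hs ht h => by
      obtain ⟨s, hsS, hω⟩ := mem_iUnion₂.1 h
      exact mem_iUnion₂.2 ⟨s, hsS, TwoSetExchange.typeMinus_openConn_of_mem Sx T hyT s hs ht hω⟩)

/-- Row 1, clean form: with `Y_S = {S↮b} ∩ {y↔b}` and `L = {S↮b} ∩ {y↮b} ∩ {y↮S}`:
`μ({o↔S} ∩ Y_S) · μ(L) ≤ μ({o↔S} ∩ L) · μ(Y_S)`. [this file] -/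
theorem attach_le_cut_block [Fintype V] (w : Sym2 V → unitInterval) (S : Finset V) (o b y : V) :
    (prodBernoulli w).real ((⋃ s ∈ S, (openConn o s : Set (BondConfig V))) ∩
        ({ω | ∀ s ∈ S, ¬ (openGraph ω).Reachable s b} ∩ openConn y b)) *
      (prodBernoulli w).real ({ω : BondConfig V | ∀ s ∈ S, ¬ (openGraph ω).Reachable s b} ∩ (openConn y b)ᶜ ∩
        (⋃ s ∈ S, (openConn y s : Set (BondConfig V)))ᶜ) ≤
    (prodBernoulli w).real ((⋃ s ∈ S, (openConn o s : Set (BondConfig V))) ∩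
        ({ω | ∀ s ∈ S, ¬ (openGraph ω).Reachable s b} ∩ (openConn y b)ᶜ ∩
          (⋃ s ∈ S, (openConn y s : Set (BondConfig V)))ᶜ)) *
      (prodBernoulli w).real ({ω : BondConfig V | ∀ s ∈ S, ¬ (openGraph ω).Reachable s b} ∩ openConn y b) := by
  have key := attach_le_cut_block_set w S o b y
  set R : Set (BondConfig V) := {ω : BondConfig V | ∀ s ∈ (↑S : Set V), ∀ t ∈ ({b, y} : Set V),
        ¬ (openGraph ω).Reachable s t} with hRdef
  have hR : ∀ ω : BondConfig V, ω ∈ R ↔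
      ((∀ s ∈ S, ¬ (openGraph ω).Reachable s b) ∧ ∀ s ∈ S, ¬ (openGraph ω).Reachable s y) := by
    intro ω
    simp only [hRdef, mem_setOf_eq, Finset.mem_coe, mem_insert_iff, mem_singleton_iff, forall_eq_or_imp, forall_eq]
    exact ⟨fun h => ⟨fun s hs => (h s hs).1, fun s hs => (h s hs).2⟩, fun h s hs => ⟨h.1 s hs, h.2 s hs⟩⟩
  have hOS : ∀ ω : BondConfig V, ω ∈ (⋃ s ∈ S, (openConn s o : Set (BondConfig V))) ↔
      ω ∈ (⋃ s ∈ S, (openConn o s : Set (BondConfig V))) := by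
    intro ω; simp only [mem_iUnion₂, openConn, mem_setOf_eq]
    exact ⟨fun ⟨s, hs, h⟩ => ⟨s, hs, rs h⟩, fun ⟨s, hs, h⟩ => ⟨s, hs, rs h⟩⟩
  have hYS : ∀ ω : BondConfig V, ω ∈ (⋃ s ∈ S, (openConn y s : Set (BondConfig V)))ᶜ ↔
      ∀ s ∈ S, ¬ (openGraph ω).Reachable s y := by
    intro ω; simp only [mem_compl_iff, mem_iUnion₂, openConn, mem_setOf_eq, not_exists]
    exact ⟨fun h s hs hsy => h s hs (rs hsy), fun h s hs hys => h s hs (rs hys)⟩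
  have e1 : R ∩ ((⋃ s ∈ S, (openConn s o : Set (BondConfig V))) ∩ openConn b y) =
      (⋃ s ∈ S, (openConn o s : Set (BondConfig V))) ∩
        ({ω | ∀ s ∈ S, ¬ (openGraph ω).Reachable s b} ∩ openConn y b) := by
    ext ω
    rw [mem_inter_iff, mem_inter_iff, hR, hOS, mem_inter_iff, mem_inter_iff]
    simp only [openConn, mem_setOf_eq]
    constructor
    · rintro ⟨⟨hSb, _⟩, hoS, hby⟩; exact ⟨hoS, hSb, rs hby⟩
    · rintro ⟨hoS, hSb, hyb⟩
      exact ⟨⟨hSb, fun s hs hsy => hSb s hs (hsy.trans hyb)⟩, hoS, rs hyb⟩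
  have e2 : R ∩ ((openConn b y : Set (BondConfig V))ᶜ ∩ univ) =
      {ω : BondConfig V | ∀ s ∈ S, ¬ (openGraph ω).Reachable s b} ∩ (openConn y b)ᶜ ∩
        (⋃ s ∈ S, (openConn y s : Set (BondConfig V)))ᶜ := by
    ext ω
    rw [mem_inter_iff, mem_inter_iff, hR, mem_inter_iff, mem_inter_iff, hYS]
    simp only [openConn, mem_setOf_eq, mem_compl_iff, mem_univ, and_true]
    constructor
    · rintro ⟨⟨hSb, hSy⟩, hby⟩; exact ⟨⟨hSb, fun hyb => hby (rs hyb)⟩, hSy⟩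
    · rintro ⟨⟨hSb, hyb⟩, hSy⟩; exact ⟨⟨hSb, hSy⟩, fun hby => hyb (rs hby)⟩
  have e3 : R ∩ ((⋃ s ∈ S, (openConn s o : Set (BondConfig V))) ∩ (openConn b y)ᶜ) =
      (⋃ s ∈ S, (openConn o s : Set (BondConfig V))) ∩
        ({ω | ∀ s ∈ S, ¬ (openGraph ω).Reachable s b} ∩ (openConn y b)ᶜ ∩
          (⋃ s ∈ S, (openConn y s : Set (BondConfig V)))ᶜ) := by
    ext ω
    rw [mem_inter_iff, mem_inter_iff, hR, hOS, mem_inter_iff, mem_inter_iff, mem_inter_iff, hYS]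
    simp only [openConn, mem_setOf_eq, mem_compl_iff]
    constructor
    · rintro ⟨⟨hSb, hSy⟩, hoS, hby⟩; exact ⟨hoS, ⟨hSb, fun hyb => hby (rs hyb)⟩, hSy⟩
    · rintro ⟨hoS, ⟨hSb, hyb⟩, hSy⟩; exact ⟨⟨hSb, hSy⟩, hoS, fun hby => hyb (rs hby)⟩
  have e4 : R ∩ ((openConn b y : Set (BondConfig V)) ∩ univ) =
      {ω : BondConfig V | ∀ s ∈ S, ¬ (openGraph ω).Reachable s b} ∩ openConn y b := by
    ext ω
    rw [mem_inter_iff, mem_inter_iff, hR, mem_inter_iff]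
    simp only [openConn, mem_setOf_eq, mem_univ, and_true]
    constructor
    · rintro ⟨⟨hSb, _⟩, hby⟩; exact ⟨hSb, rs hby⟩
    · rintro ⟨hSb, hyb⟩; exact ⟨⟨hSb, fun s hs hsy => hSb s hs (hsy.trans hyb)⟩, rs hyb⟩
  rw [e1, e2, e3, e4] at key
  exact key

/-- Row 2, clean form: with `D_S = {S↮b} ∩ {y↮b}`, `O = {o↔S} ∪ {o↔y}`, `Y = {y ↔ S}`:
`μ(O ∩ D_S) · μ(D_S ∩ Y) ≤ μ(D_S) · μ(O ∩ D_S ∩ Y)`. [this file] -/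
theorem join_posCorr_block [Fintype V] (w : Sym2 V → unitInterval) (S : Finset V) (o b y : V) :
    (prodBernoulli w).real (((⋃ s ∈ S, (openConn o s : Set (BondConfig V))) ∪ openConn o y) ∩
        ({ω | ∀ s ∈ S, ¬ (openGraph ω).Reachable s b} ∩ (openConn y b)ᶜ)) *
      (prodBernoulli w).real (({ω : BondConfig V | ∀ s ∈ S, ¬ (openGraph ω).Reachable s b} ∩ (openConn y b)ᶜ) ∩
        ⋃ s ∈ S, (openConn y s : Set (BondConfig V))) ≤
    (prodBernoulli w).real ({ω : BondConfig V | ∀ s ∈ S, ¬ (openGraph ω).Reachable s b} ∩ (openConn y b)ᶜ) *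
      (prodBernoulli w).real (((⋃ s ∈ S, (openConn o s : Set (BondConfig V))) ∪ openConn o y) ∩
        ({ω | ∀ s ∈ S, ¬ (openGraph ω).Reachable s b} ∩ (openConn y b)ᶜ) ∩
          ⋃ s ∈ S, (openConn y s : Set (BondConfig V))) := by
  have key := join_posCorr_block_set w S o b y
  set R : Set (BondConfig V) := {ω : BondConfig V | ∀ s ∈ ({b} : Set V), ∀ t ∈ (insert y ↑S : Set V),
        ¬ (openGraph ω).Reachable s t} with hRdef
  have hR : ∀ ω : BondConfig V, ω ∈ R ↔
      ω ∈ ({ω : BondConfig V | ∀ s ∈ S, ¬ (openGraph ω).Reachable s b} ∩ (openConn y b)ᶜ) := by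
    intro ω
    simp only [hRdef, mem_setOf_eq, mem_singleton_iff, forall_eq, mem_insert_iff, Finset.mem_coe, forall_eq_or_imp,
      mem_inter_iff, mem_compl_iff, openConn]
    exact ⟨fun h => ⟨fun s hs hsb => h.2 s hs (rs hsb), fun hyb => h.1 (rs hyb)⟩,
      fun h => ⟨fun hby => h.2 (rs hby), fun s hs hbs => h.1 s hs (rs hbs)⟩⟩
  have hO : ∀ ω : BondConfig V, ω ∈ ((⋃ s ∈ S, (openConn s o : Set (BondConfig V))) ∪ openConn y o) ↔
      ω ∈ ((⋃ s ∈ S, (openConn o s : Set (BondConfig V))) ∪ openConn o y) := by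
    intro ω; simp only [mem_union, mem_iUnion₂, openConn, mem_setOf_eq]
    exact ⟨fun h => h.imp (fun ⟨s, hs, h⟩ => ⟨s, hs, rs h⟩) rs, fun h => h.imp (fun ⟨s, hs, h⟩ => ⟨s, hs, rs h⟩) rs⟩
  have f1 : R ∩ (univ ∩ ((⋃ s ∈ S, (openConn s o : Set (BondConfig V))) ∪ openConn y o)) =
      ((⋃ s ∈ S, (openConn o s : Set (BondConfig V))) ∪ openConn o y) ∩
        ({ω | ∀ s ∈ S, ¬ (openGraph ω).Reachable s b} ∩ (openConn y b)ᶜ) := by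
    ext ω; simp only [mem_inter_iff, mem_univ, true_and, hR ω, hO ω]; tauto
  have f2 : R ∩ (univ ∩ ⋃ s ∈ S, (openConn y s : Set (BondConfig V))) =
      ({ω : BondConfig V | ∀ s ∈ S, ¬ (openGraph ω).Reachable s b} ∩ (openConn y b)ᶜ) ∩
        ⋃ s ∈ S, (openConn y s : Set (BondConfig V)) := by
    ext ω; simp only [mem_inter_iff, mem_univ, true_and, hR ω]
  have f3 : R ∩ (univ ∩ univ) = {ω : BondConfig V | ∀ s ∈ S, ¬ (openGraph ω).Reachable s b} ∩ (openConn y b)ᶜ := by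
    ext ω; simp only [mem_inter_iff, mem_univ, and_true, hR ω]
  have f4 : R ∩ ((((⋃ s ∈ S, (openConn s o : Set (BondConfig V))) ∪ openConn y o)) ∩
      ⋃ s ∈ S, (openConn y s : Set (BondConfig V))) =
      ((⋃ s ∈ S, (openConn o s : Set (BondConfig V))) ∪ openConn o y) ∩
        ({ω | ∀ s ∈ S, ¬ (openGraph ω).Reachable s b} ∩ (openConn y b)ᶜ) ∩
          ⋃ s ∈ S, (openConn y s : Set (BondConfig V)) := by
    ext ω; simp only [mem_inter_iff, hR ω, hO ω]; tauto
  rw [f1, f2, f3, f4] at key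
  exact key

/-- **The block two-point step (PROVED).**  For a finite vertex set `S`, vertices `o, b, y`, with
`d_S = μ(S↮b) ≥ d_y = μ(y↮b)` and `μ(L) > 0`, `L = {S↮b} ∩ {y↮b} ∩ {y↮S}`:
`μ({o↔S} ∩ {S↮b})/μ(S↮b) + [μ({y↮S} ∩ {y↮b})/μ(y↮b)] · [μ({o↔y} ∩ L)/μ(L)]`
`≤ μ(({o↔S} ∪ {o↔y}) ∩ {S↮b} ∩ {y↮b}) / μ({S↮b} ∩ {y↮b})`. [this file] -/
theorem blockStep [Fintype V] (w : Sym2 V → unitInterval) (S : Finset V) (o b y : V)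
    (hord : (prodBernoulli w).real (openConn y b : Set (BondConfig V))ᶜ ≤
      (prodBernoulli w).real {ω : BondConfig V | ∀ s ∈ S, ¬ (openGraph ω).Reachable s b})
    (hL : 0 < (prodBernoulli w).real ({ω : BondConfig V | ∀ s ∈ S, ¬ (openGraph ω).Reachable s b} ∩
      (openConn y b)ᶜ ∩ (⋃ s ∈ S, (openConn y s : Set (BondConfig V)))ᶜ)) :
    (prodBernoulli w).real ((⋃ s ∈ S, (openConn o s : Set (BondConfig V))) ∩
          {ω | ∀ s ∈ S, ¬ (openGraph ω).Reachable s b}) /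
        (prodBernoulli w).real {ω : BondConfig V | ∀ s ∈ S, ¬ (openGraph ω).Reachable s b} +
      (prodBernoulli w).real ((⋃ s ∈ S, (openConn y s : Set (BondConfig V)))ᶜ ∩ (openConn y b)ᶜ) /
          (prodBernoulli w).real (openConn y b : Set (BondConfig V))ᶜ *
        ((prodBernoulli w).real ((openConn o y : Set (BondConfig V)) ∩
            ({ω | ∀ s ∈ S, ¬ (openGraph ω).Reachable s b} ∩ (openConn y b)ᶜ ∩
              (⋃ s ∈ S, (openConn y s : Set (BondConfig V)))ᶜ)) /
          (prodBernoulli w).real ({ω : BondConfig V | ∀ s ∈ S, ¬ (openGraph ω).Reachable s b} ∩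
            (openConn y b)ᶜ ∩ (⋃ s ∈ S, (openConn y s : Set (BondConfig V)))ᶜ)) ≤
    (prodBernoulli w).real (((⋃ s ∈ S, (openConn o s : Set (BondConfig V))) ∪ openConn o y) ∩
        ({ω | ∀ s ∈ S, ¬ (openGraph ω).Reachable s b} ∩ (openConn y b)ᶜ)) /
      (prodBernoulli w).real ({ω : BondConfig V | ∀ s ∈ S, ¬ (openGraph ω).Reachable s b} ∩ (openConn y b)ᶜ) := by
  set μ := prodBernoulli w with hμ
  -- events
  set SB : Set (BondConfig V) := {ω : BondConfig V | ∀ s ∈ S, ¬ (openGraph ω).Reachable s b} with hSB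
  set Yb : Set (BondConfig V) := (openConn y b : Set (BondConfig V)) with hYb
  set YU : Set (BondConfig V) := ⋃ s ∈ S, (openConn y s : Set (BondConfig V)) with hYU
  set OS : Set (BondConfig V) := ⋃ s ∈ S, (openConn o s : Set (BondConfig V)) with hOSd
  set Oy : Set (BondConfig V) := (openConn o y : Set (BondConfig V)) with hOy
  -- masses
  set dS := μ.real SB with hdS
  set dy := μ.real Ybᶜ with hdy
  set Dv := μ.real (SB ∩ Ybᶜ) with hDv
  set Yv := μ.real (SB ∩ Yb) with hYv
  set Xv := μ.real (Ybᶜ ∩ SBᶜ) with hXv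
  set q := μ.real (SB ∩ Ybᶜ ∩ YUᶜ) with hq
  set m := μ.real ((SB ∩ Ybᶜ) ∩ YU) with hm
  set Xp := μ.real ((YUᶜ ∩ Ybᶜ) ∩ SBᶜ) with hXp
  set c6 := μ.real (OS ∩ (SB ∩ Yb)) with hc6
  set nx := μ.real (OS ∩ (SB ∩ Ybᶜ ∩ YUᶜ)) with hnx
  set ny := μ.real (Oy ∩ (SB ∩ Ybᶜ ∩ YUᶜ)) with hny
  set J := μ.real ((OS ∪ Oy) ∩ (SB ∩ Ybᶜ) ∩ YU) with hJ
  set N := μ.real ((OS ∪ Oy) ∩ (SB ∩ Ybᶜ)) with hN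
  -- rows
  have r1 : c6 * q ≤ nx * Yv := attach_le_cut_block w S o b y
  have r2 : N * m ≤ Dv * J := join_posCorr_block w S o b y
  -- splits
  have s_dS : Yv + Dv = dS := OwnDisconnection.split w SB Yb
  have s_dy : Dv + Xv = dy := by
    have h := OwnDisconnection.split w Ybᶜ SB
    rw [show Ybᶜ ∩ SB = SB ∩ Ybᶜ from inter_comm _ _] at h; exact h
  have s_Dv : m + q = Dv := OwnDisconnection.split w (SB ∩ Ybᶜ) YU
  have s_YU : q + Xp = μ.real (YUᶜ ∩ Ybᶜ) := by
    have h := OwnDisconnection.split w (YUᶜ ∩ Ybᶜ) SB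
    rw [show YUᶜ ∩ Ybᶜ ∩ SB = SB ∩ Ybᶜ ∩ YUᶜ by ext ω; simp only [mem_inter_iff]; tauto] at h; exact h
  have hXp : Xp ≤ Xv := measureReal_mono (Set.inter_subset_inter_left SBᶜ Set.inter_subset_right)
  -- `J` only sees `o ↔ S`: on `{y ↔ S}`, `o ↔ y` implies `o ↔ S`
  have eJ : (OS ∪ Oy) ∩ (SB ∩ Ybᶜ) ∩ YU = OS ∩ (SB ∩ Ybᶜ) ∩ YU := by
    ext ω
    constructor
    · rintro ⟨⟨h, hD⟩, hY⟩
      rcases h with hOS | hoy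
      · exact ⟨⟨hOS, hD⟩, hY⟩
      · have hY' := hY
        rw [hYU, mem_iUnion₂] at hY'
        obtain ⟨s, hs, hys⟩ := hY'
        refine ⟨⟨?_, hD⟩, hY⟩
        rw [hOSd, mem_iUnion₂]
        exact ⟨s, hs, show (openGraph ω).Reachable o s from (show (openGraph ω).Reachable o y from hoy).trans hys⟩
    · rintro ⟨⟨hOS, hD⟩, hY⟩; exact ⟨⟨Or.inl hOS, hD⟩, hY⟩
  -- given `y ↮ S`, `{o↔S}` and `{o↔y}` are disjoint
  have eL : (OS ∪ Oy) ∩ (SB ∩ Ybᶜ) ∩ YUᶜ = (OS ∩ (SB ∩ Ybᶜ ∩ YUᶜ)) ∪ (Oy ∩ (SB ∩ Ybᶜ ∩ YUᶜ)) := by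
    ext ω; simp only [mem_inter_iff, mem_union]; tauto
  have hdisj : Disjoint (OS ∩ (SB ∩ Ybᶜ ∩ YUᶜ)) (Oy ∩ (SB ∩ Ybᶜ ∩ YUᶜ)) := by
    rw [Set.disjoint_left]
    rintro ω ⟨hOS, _, hyu⟩ ⟨hoy, _⟩
    rw [hOSd, mem_iUnion₂] at hOS
    obtain ⟨s, hs, hos⟩ := hOS
    apply hyu
    rw [hYU, mem_iUnion₂]
    exact ⟨s, hs, show (openGraph ω).Reachable y s from (rs (show (openGraph ω).Reachable o y from hoy)).trans hos⟩
  have s_N : J + (nx + ny) = N := by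
    have h := OwnDisconnection.split w ((OS ∪ Oy) ∩ (SB ∩ Ybᶜ)) YU
    rw [eL, measureReal_union hdisj MeasurableSet.of_discrete] at h
    exact h
  have s_OS : c6 + (J + nx) = μ.real (OS ∩ SB) := by
    have h1 := OwnDisconnection.split w (OS ∩ SB) Yb
    rw [Set.inter_assoc OS SB Yb, Set.inter_assoc OS SB Ybᶜ] at h1
    have h2 := OwnDisconnection.split w (OS ∩ (SB ∩ Ybᶜ)) YU
    rw [← eJ, Set.inter_assoc OS (SB ∩ Ybᶜ) YUᶜ] at h2
    rw [hc6, hJ, hnx, hμ]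
    linarith only [h1, h2]
  -- nonnegativity (before making the masses opaque)
  have hm0 : 0 ≤ m := measureReal_nonneg
  have hYv0 : 0 ≤ Yv := measureReal_nonneg
  have hXv0 : 0 ≤ Xv := measureReal_nonneg
  have hnx0 : 0 ≤ nx := measureReal_nonneg
  have hny0 : 0 ≤ ny := measureReal_nonneg
  have hc60 : 0 ≤ c6 := measureReal_nonneg
  have hJ0 : 0 ≤ J := measureReal_nonneg
  have hG : μ.real (YUᶜ ∩ Ybᶜ) ≤ q + Xv := by rw [← s_YU]; linarith only [hXp]
  have hLHS : μ.real (OS ∩ SB) = c6 + (J + nx) := s_OS.symm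
  rw [hLHS]
  set gv := μ.real (YUᶜ ∩ Ybᶜ) with hgv
  clear_value gv dS dy Dv Yv Xv q m Xp c6 nx ny J N
  -- positivity and order
  have hq0 : 0 < q := hL
  have hDv : 0 < Dv := by rw [← s_Dv]; linarith only [hm0, hq0]
  have hdS : 0 < dS := by rw [← s_dS]; linarith only [hYv0, hDv]
  have hdy : 0 < dy := by rw [← s_dy]; linarith only [hXv0, hDv]
  have hYX : Xv ≤ Yv := by
    have h : dy ≤ dS := hord
    rw [← s_dS, ← s_dy] at h; linarith only [h]
  -- the key inequality `ny·Xv·m·dS ≤ U·q·dy`, `U = (nx+J)·Yv − c6·Dv`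
  have k2 : (nx + ny) * m ≤ J * q := by
    have h := r2
    rw [← s_N, ← s_Dv] at h
    have e : (m + q) * J - (J + (nx + ny)) * m = J * q - (nx + ny) * m := by ring
    linarith only [h, e]
  have kU : Yv * (ny * m) ≤ ((nx + J) * Yv - c6 * Dv) * q := by
    rw [← s_Dv]
    have h1 : c6 * q * (m + q) ≤ nx * Yv * (m + q) :=
      mul_le_mul_of_nonneg_right r1 (by linarith only [hm0, hq0])
    have h2 : (nx + ny) * m * Yv ≤ J * q * Yv := mul_le_mul_of_nonneg_right k2 hYv0
    have e : ((nx + J) * Yv - c6 * (m + q)) * q - Yv * (ny * m) =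
        (nx * Yv * (m + q) - c6 * q * (m + q)) + (J * q * Yv - (nx + ny) * m * Yv) := by ring
    linarith only [h1, h2, e]
  have kXY : Xv * dS ≤ Yv * dy := by
    rw [← s_dS, ← s_dy]
    have h := mul_le_mul_of_nonneg_right hYX hDv.le
    have e : Yv * (Dv + Xv) - Xv * (Yv + Dv) = Yv * Dv - Xv * Dv := by ring
    linarith only [h, e]
  have key : ny * Xv * m * dS ≤ ((nx + J) * Yv - c6 * Dv) * q * dy := by
    have hnm : 0 ≤ ny * m := mul_nonneg hny0 hm0
    calc ny * Xv * m * dS = (ny * m) * (Xv * dS) := by ring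
      _ ≤ (ny * m) * (Yv * dy) := mul_le_mul_of_nonneg_left kXY hnm
      _ = (Yv * (ny * m)) * dy := by ring
      _ ≤ (((nx + J) * Yv - c6 * Dv) * q) * dy := mul_le_mul_of_nonneg_right kU hdy.le
      _ = ((nx + J) * Yv - c6 * Dv) * q * dy := by ring
  -- bound the second term's weight: `μ(y↮S, y↮b) = q + Xp ≤ q + Xv`
  have hterm2 : gv / dy * (ny / q) ≤ (q + Xv) / dy * (ny / q) :=
    mul_le_mul_of_nonneg_right (div_le_div_of_nonneg_right hG hdy.le) (div_nonneg hny0 hq0.le)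
  -- assemble
  refine (add_le_add le_rfl hterm2).trans ?_
  rw [show (q + Xv) / dy * (ny / q) = ((q + Xv) * ny) / (dy * q) by rw [div_mul_div_comm],
    div_add_div _ _ hdS.ne' (mul_pos hdy hq0).ne', div_le_div_iff₀ (mul_pos hdS (mul_pos hdy hq0)) hDv]
  have hid : N * (dS * (dy * q)) - ((c6 + (J + nx)) * (dy * q) + dS * ((q + Xv) * ny)) * Dv =
      ((nx + J) * Yv - c6 * Dv) * q * dy - ny * Xv * m * dS := by
    rw [← s_N, ← s_dS, ← s_dy, ← s_Dv]; ring
  linarith only [key, hid]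

end BlockStep

end Summit.CriticalPhenomena.PercolationContinuityZ3.Theorems

end
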